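import Summits.BirchSwinnertonDyer.BirchSwinnertonDyer.Theorems.SchneiderFreeAdditiveX3LocalGaloisDegreeOne
import Literature.NumberTheory.GaloisRepresentations.LocalInertiaComapRestrict
import Literature.NumberTheory.GaloisRepresentations.ModPCyclotomicCharacterInertiaSurjective
import Literature.NumberTheory.GaloisRepresentations.ModPGaloisRep
import Summits.BirchSwinnertonDyer.BirchSwinnertonDyer.Theorems.PrintCFramBottomClassIndexLawFiveLeLevelDictionaryPadic
import HarnessLib

/-!
# Crux 4 `BSDpOnCellC` (stmt-BirchSwinnertonDyer-19034), line `telescope`, leaf N2 / sub-leaf W2: HYPOTHESIS (μ) DISCHARGED —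
# at a prime `𝔮 ∣ p` of DEGREE ONE of a number field, no primitive `p`-th root of unity of `K̄_𝔮` is fixed by the inertia group
# (`ℚ_p(ζ_p)/ℚ_p` is ramified; helper, `--supports stmt-BirchSwinnertonDyer-19034 --as helper`; closes nothing; NOT the registered text)

Cell `bsd-eis`, width seat `bsd-line-x2-p2` (prover g20, 2026-08-30; D-0154 KEY row 5). THEOREMS ONLY: no definition, no named fact,
no `sorry`, no instance, no notation. Hypothesis (μ) of this seat's `TelescopeK2FixedTorsionFiniteMult.finite_fixed_torsion_of_mult` /
`TelescopeK2WeightTwoControlMapOfMult.exists_weightTwoControlMap_of_mult` reads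
`∀ ζ : K̄_𝔮, (∀ σ ∈ absInertia K_𝔮, σ • ζ = ζ) → ζ ^ p = 1 → ζ = 1`. PROOF (Serre, *Corps locaux* IV §4 Prop. 17–18, through the tree):
let `v` be the place of `ℚ` below `𝔮`; the mod `p` cyclotomic character maps `absInertia ℚ_v` ONTO `(ℤ/p)ˣ`
(tree `Rat.exists_mem_absInertia_adicCompletion_modPCyclotomicCharacterZMod_eq`), so some `τ ∈ I_{ℚ_v}` acts on the `p`-th roots of unity
by `u = −1 ≠ 1` (`p ≠ 2`); at a degree-one `𝔮` the canonical map `ℚ_v → K_𝔮` is onto (tree `surjective_adicCompletionOfLiesOver`), so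
`Γ_{K_𝔮} → Γ_{ℚ_v}` is onto (tree `SchneiderFreeAdditiveX3.absGaloisRestrict_adicCompletion_surjective_of_degreeOne`) and `τ` lifts to `σ`,
which lies in `I_{K_𝔮} = res⁻¹(I_{ℚ_v})` (tree `mem_absInertia_iff_absGaloisRestrict_mem`) and moves `ζ` (equivariance of the chosen
`ℚ̄_v → K̄_𝔮`, tree `absGaloisRestrict_apply_smul`).

* **`eq_one_of_pow_prime_eq_one_of_forall_absInertia`** — (μ) at a degree-one `𝔮 ∣ p`, `p ≠ 2`.

HONEST FRAMING: local bookkeeping over tree theorems; nothing about any curve; no registered stub, crux or summit statement is proved by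
this file; closes: none.

References: [SerreLocalFields1979] Ch. IV §4, Prop. 17 (ii)(iii), Prop. 18 (pp. 77–78) and Ch. I §7 Prop. 22; [SerreInventiones1972] §1.8.
-/

noncomputable section

-- D-0017: single-problem summit, the namespace repeats the problem name by design.
set_option linter.dupNamespace false
set_option autoImplicit false

open scoped Classical
open Field IsDedekindDomain NumberField Rat.HeightOneSpectrum
open Literature.NumberTheory.GaloisRepresentations Literature.NumberTheory.Automorphic

namespace Summit.BirchSwinnertonDyer.BirchSwinnertonDyer.Theorems.TelescopeK2InertiaMovesRootsOfUnity

/-- **(μ) AT A DEGREE-ONE PRIME: no primitive `p`-th root of unity of `K̄_𝔮` is fixed by the inertia group of `K_𝔮`** (`K` a number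
field, `𝔮 ∋ p` with `e(𝔮|p) = f(𝔮|p) = 1`, `p ≠ 2`): `K_𝔮(ζ_p) = ℚ_p(ζ_p)` is (totally) ramified. See the module docstring for the route.
[cite: SerreLocalFields1979, Ch. IV §4, Prop. 17 (ii)(iii) and Prop. 18 (pp. 77–78)] [cite: SerreLocalFields1979, Ch. I §7 Prop. 22 a)] -/
theorem eq_one_of_pow_prime_eq_one_of_forall_absInertia {K : Type} [Field K] [NumberField K] {p : ℕ} [hp : Fact p.Prime]
    (hp2 : p ≠ 2) (𝔮 : HeightOneSpectrum (𝓞 K)) (h𝔮 : ((p : ℕ) : 𝓞 K) ∈ 𝔮.asIdeal)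
    (he : 𝔮.asIdeal.ramificationIdx (𝓞 ℚ) = 1) (hf : 𝔮.asIdeal.inertiaDeg (𝓞 ℚ) = 1)
    (ζ : AlgebraicClosure (𝔮.adicCompletion K))
    (hfix : ∀ σ ∈ absInertia (𝔮.adicCompletion K), σ • ζ = ζ) (hζ : ζ ^ p = 1) : ζ = 1 := by
  by_contra hne
  have hpP : p.Prime := hp.out
  -- the place `v` of `ℚ` below `𝔮` and the canonical (onto) map `ℚ_v → K_𝔮`
  let v : HeightOneSpectrum (𝓞 ℚ) := 𝔮.under (𝓞 ℚ)
  have hpv : ((p : ℕ) : 𝓞 ℚ) ∈ v.asIdeal := by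
    change ((p : ℕ) : 𝓞 ℚ) ∈ 𝔮.asIdeal.comap (algebraMap (𝓞 ℚ) (𝓞 K))
    rw [Ideal.mem_comap, map_natCast]
    exact h𝔮
  haveI : 𝔮.asIdeal.LiesOver v.asIdeal := ⟨rfl⟩
  letI := (adicCompletionOfLiesOver ℚ K v 𝔮).toAlgebra
  have hsurjι : Function.Surjective (algebraMap (v.adicCompletion ℚ) (𝔮.adicCompletion K)) :=
    surjective_adicCompletionOfLiesOver ℚ K v 𝔮 he hf
  haveI : Algebra.IsAlgebraic (v.adicCompletion ℚ) (𝔮.adicCompletion K) :=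
    ⟨fun x => by
      obtain ⟨y, rfl⟩ := hsurjι x
      exact isAlgebraic_algebraMap y⟩
  haveI : CharZero (v.adicCompletion ℚ) := charZero_of_injective_algebraMap (algebraMap ℚ (v.adicCompletion ℚ)).injective
  haveI : NeZero ((p : ℕ) : v.adicCompletion ℚ) := NeZero.charZero
  -- transport `ζ` to `ℚ̄_v`
  set ζ' : AlgebraicClosure (v.adicCompletion ℚ) := (absClosureEquiv (v.adicCompletion ℚ) (𝔮.adicCompletion K)).symm ζ with hζ'
  have hι : absClosureEmbedding (v.adicCompletion ℚ) (𝔮.adicCompletion K) ζ' = ζ :=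
    (absClosureEquiv (v.adicCompletion ℚ) (𝔮.adicCompletion K)).apply_symm_apply ζ
  have hζ'p : ζ' ^ p = 1 := by rw [hζ', ← map_pow, hζ, map_one]
  have hζ'1 : ζ' ≠ 1 := fun h1 => hne (by rw [← hι, h1, map_one])
  haveI : NeZero p := ⟨hpP.ne_zero⟩
  have hprim : IsPrimitiveRoot ζ' p := by
    have h := IsPrimitiveRoot.orderOf ζ'
    rwa [orderOf_eq_prime hζ'p hζ'1] at h
  -- an inertia element of `ℚ_v` acting on the `p`-th roots of unity by `-1 ≠ 1`
  have hu : (-1 : (ZMod p)ˣ) ≠ 1 := fun h => by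
    have h2 : ((2 : ℕ) : ZMod p) = 0 := by
      have h' : (-1 : ZMod p) = 1 := by simpa using congrArg (fun x : (ZMod p)ˣ => (x : ZMod p)) h
      calc ((2 : ℕ) : ZMod p) = 1 + 1 := by norm_num
        _ = 1 + -1 := by rw [h']
        _ = 0 := by ring
    exact hp2 ((Nat.prime_dvd_prime_iff_eq hpP Nat.prime_two).1 ((ZMod.natCast_eq_zero_iff 2 p).1 h2))
  obtain ⟨τ, hτI, hτ⟩ := Rat.exists_mem_absInertia_adicCompletion_modPCyclotomicCharacterZMod_eq v
    (PrintCFram.LevelDictionary.primesEquiv_eq_of_natCast_mem v hpP hpv) (-1 : (ZMod p)ˣ)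
  have hmove : τ • ζ' ≠ ζ' := by
    intro hτζ
    have hspec := modPCyclotomicCharacterZMod_spec (v.adicCompletion ℚ) p τ ζ' hζ'p
    rw [hτ, hτζ] at hspec
    -- `ζ' = ζ' ^ val(-1)`, so `val(-1) = 1`, so `-1 = 1` in `(ℤ/p)ˣ`
    have hval : (((-1 : (ZMod p)ˣ) : ZMod p)).val = 1 :=
      hprim.pow_inj (ZMod.val_lt _) hpP.one_lt (by rw [pow_one]; exact hspec.symm)
    exact hu (Units.ext ((ZMod.val_eq_one hpP.one_lt _).1 hval))
  -- lift `τ` to `Γ_{K_𝔮}`; the lift lies in the inertia group and moves `ζ`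
  obtain ⟨σ, hσ⟩ := SchneiderFreeAdditiveX3.absGaloisRestrict_adicCompletion_surjective_of_degreeOne K v 𝔮 he hf τ
  have hσI : σ ∈ absInertia (𝔮.adicCompletion K) :=
    (mem_absInertia_iff_absGaloisRestrict_mem (v.adicCompletion ℚ) σ).2 (hσ ▸ hτI)
  have h1 : σ • ζ = absClosureEmbedding (v.adicCompletion ℚ) (𝔮.adicCompletion K) (τ • ζ') := by
    rw [← hι, ← absGaloisRestrict_apply_smul, hσ]
  have h2 := hfix σ hσI
  rw [h1, ← hι] at h2
  exact hmove ((absClosureEmbedding (v.adicCompletion ℚ) (𝔮.adicCompletion K)).injective h2)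

end Summit.BirchSwinnertonDyer.BirchSwinnertonDyer.Theorems.TelescopeK2InertiaMovesRootsOfUnity

end
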